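import Summits.CriticalPhenomena.PercolationContinuityZ3.Theorems.FK.PressureFieldDerivative
import Mathlib.Probability.Moments.Basic
import Mathlib.MeasureTheory.Measure.Tilted
import HarnessLib

/-!
# THE MAGNETISATION IS AN EXPONENTIAL FAMILY IN THE FIELD: `⟨e^{βs M_Λ}⟩^{bc}_{Λ;β,h} = Z^{bc}_{Λ;β,h+s} / Z^{bc}_{Λ;β,h}`,
# AND THE CHERNOFF (EXPONENTIAL CHEBYSHEV) BOUNDS ON THE TAILS OF `M_Λ = Σ_{x∈Λ} σ_x` IN FINITE VOLUME
# (Ellis 2006, §IV.5 eq. (4.33) and Thm. II.6.1; Lanford 1973)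

Claimed R42 (8)(c) in the cell INBOX at 2026-08-29T07:20:29Z by fkp-10a gen 359 (NEW CLAIM #1 of the gen), addressed to the lane under (ι) (coordinator fk-4 gen 293 CLOSED l.8789 06:52:14Z 2026-08-29; «(ι) RESUMES») and to the next seated fk-4 generation (ruling R172 requested); lineage row FO-10a-g359 (self-suggested), package g359-largedev, label LD-A.
Helper file of the `fk-continuity` build cell (bschramm lane; `--supports stmt-CriticalPhenomena-4575`); builds on
p205010 (kernel theorem, internal audit signed; external expert review pending). No definitions, no named facts, no
sorries; standard axioms. UNCONDITIONAL (nearest-neighbour Ising model on ANY locally finite graph `G`, ANY finite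
volume `Λ`, ANY boundary condition, EVERY real `β`, `h`; the tree's parametrisation `exp(β Σ_e σ_e + βh Σ_x σ_x)`).

Ellis (2006), proof of Thm. IV.5.5, eq. (4.33): the free energy function of the total spin `S_Λ` under the
finite-volume Gibbs states `{P_{Λ,β,h}}` is `c_{Λ,β,h}(t) = |Λ|⁻¹ log (Z(Λ,β,h+t/β)/Z(Λ,β,h))`, because
`-βH_{Λ,h} + t S_Λ = -βH_{Λ,h+t/β}`. Here, with `M_Λ(σ) = Σ_{x∈Λ} σ_x` and `t = βs`:

* `isingHamiltonian_add_field`, `isingWeight_add_field` — `H_{Λ;h+s} = H_{Λ;h} − s M_Λ`, `w_{β,h+s} = w_{β,h} e^{βs M_Λ}`;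
* **`isingMeasure_add_field_eq_tilted`** — THE GIBBS MEASURES IN A FIELD FORM AN EXPONENTIAL FAMILY:
  `μ^{bc}_{Λ;β,h+s} = (μ^{bc}_{Λ;β,h}).tilted (βs M_Λ)` (Mathlib `Measure.tilted`);
* **`integral_exp_mul_sum_spinAt`** / `mgf_sum_spinAt` / `cgf_sum_spinAt` — `⟨e^{βs M_Λ}⟩^{bc}_{Λ;β,h} = Z_{h+s}/Z_h`,
  `cgf_{M_Λ}(βs) = log Z_{h+s} − log Z_h = |Λ| (ψ^{bc}_Λ(β,h+s) − ψ^{bc}_Λ(β,h))` (`cgf_sum_spinAt_eq_card_mul`);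
* Jensen: `mul_sum_isingCorr_le_log_sub` — `βs Σ_x ⟨σ_x⟩_h ≤ log Z_{h+s} − log Z_h ≤ βs Σ_x ⟨σ_x⟩_{h+s}`
  (`log_sub_le_mul_sum_isingCorr`; convexity of `log Z` in `h`, `d/dh log Z = β Σ_x ⟨σ_x⟩`);
* **CHERNOFF BOUNDS** (`0 ≤ βs`, every `a`): `measureReal_le_sum_spinAt_le` —
  `μ^{bc}_{Λ;β,h}{a ≤ M_Λ} ≤ e^{−βsa} Z_{h+s}/Z_h`; `measureReal_sum_spinAt_le_le` — `μ{M_Λ ≤ a} ≤ e^{βsa} Z_{h−s}/Z_h`;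
  in pressure form `measureReal_le_sum_spinAt_le_exp_card` —
  `μ{m|Λ| ≤ M_Λ} ≤ exp(−|Λ| (βsm − (ψ^{bc}_Λ(β,h+s) − ψ^{bc}_Λ(β,h))))` and `measureReal_sum_spinAt_le_le_exp_card`;
  in mean form `measureReal_le_sum_spinAt_le_exp_mean` — `μ_h{a ≤ M_Λ} ≤ exp(−βs (a − Σ_x⟨σ_x⟩_{h+s}))` and
  `measureReal_sum_spinAt_le_le_exp_mean` — `μ_h{M_Λ ≤ a} ≤ exp(βs (a − Σ_x⟨σ_x⟩_{h−s}))`: in finite volume the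
  magnetisation concentrates, at exponential rate in the excess, above the tilted means `Σ_x⟨σ_x⟩_{h−s}` and below
  `Σ_x⟨σ_x⟩_{h+s}`.

## References

* R. S. Ellis, *Entropy, Large Deviations, and Statistical Mechanics*, Springer (1985/2006), §II.6 (Thm. II.6.1,
  free energy function (2.28)), §IV.5 (proof of Thm. IV.5.5, eq. (4.33)), §V.6–V.7 (eq. (5.26)), §VII.3. [Ellis2006]
* O. E. Lanford, *Entropy and equilibrium states in classical statistical mechanics*, in: Statistical Mechanics
  and Mathematical Problems, LNP 20, Springer (1973), 1–113. [Lanford1973]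
* S. Friedli, Y. Velenik, *Statistical Mechanics of Lattice Systems*, CUP (2017), §3.2.1 (pressure, eq. (3.7)),
  Lemma 3.5 (convexity of `log Z` in `h`). [FriedliVelenik2017]
-/

noncomputable section

namespace Summit.CriticalPhenomena.PercolationContinuityZ3.Theorems.FK

namespace IsingLargeDeviations

open MeasureTheory ProbabilityTheory Filter Topology Finset Set
open Literature.Probability.LatticeModels

variable {V : Type*} (G : SimpleGraph V) [DecidableEq V] [G.LocallyFinite]

/-! ### The total spin `M_Λ = Σ_{x∈Λ} σ_x`: measurability and exponential moments (`|M_Λ| ≤ |Λ|`, Literature `abs_sum_spinAt_le`) -/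

omit [DecidableEq V] in
/-- `σ ↦ M_Λ(σ) = Σ_{x∈Λ} σ_x` is measurable. [folklore] -/
@[fun_prop]
theorem measurable_sum_spinAt (Λ : Finset V) : Measurable fun σ : SpinConfig V => ∑ x ∈ Λ, spinAt x σ :=
  Finset.measurable_sum _ fun x _ => measurable_spinAt x

omit [DecidableEq V] in
/-- `e^{t M_Λ}` is integrable under any finite measure on configurations (`M_Λ` is bounded and measurable).
[folklore] -/
theorem integrable_exp_mul_sum_spinAt (Λ : Finset V) (μ : Measure (SpinConfig V)) [IsFiniteMeasure μ] (t : ℝ) :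
    Integrable (fun σ : SpinConfig V => Real.exp (t * ∑ x ∈ Λ, spinAt x σ)) μ := by
  refine Integrable.mono' (integrable_const (Real.exp (|t| * #Λ)))
    ((measurable_sum_spinAt Λ).const_mul t).exp.aestronglyMeasurable (ae_of_all _ fun σ => ?_)
  rw [Real.norm_eq_abs, abs_of_pos (Real.exp_pos _), Real.exp_le_exp]
  calc t * ∑ x ∈ Λ, spinAt x σ ≤ |t * ∑ x ∈ Λ, spinAt x σ| := le_abs_self _
    _ = |t| * |∑ x ∈ Λ, spinAt x σ| := abs_mul _ _
    _ ≤ |t| * #Λ := mul_le_mul_of_nonneg_left (abs_sum_spinAt_le σ Λ) (abs_nonneg t)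

/-! ### Shifting the field tilts the Gibbs measure by `e^{βs M_Λ}` -/

/-- **`H^{bc}_{Λ;h+s}(σ) = H^{bc}_{Λ;h}(σ) − s M_Λ(σ)`** (the field couples linearly to the total spin).
[cite: Ellis2006, §IV.5, proof of Thm. IV.5.5 (eq. before (4.33))] -/
theorem isingHamiltonian_add_field (Λ : Finset V) (h s : ℝ) (bc : BoundaryCondition V) (σ : SpinConfig V) :
    isingHamiltonian G Λ (h + s) bc σ = isingHamiltonian G Λ h bc σ - s * ∑ x ∈ Λ, spinAt x σ := by
  simp only [isingHamiltonian]
  ring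

/-- **`w^{bc}_{Λ;β,h+s}(τ) = w^{bc}_{Λ;β,h}(τ) · exp(βs M_Λ(τ))`** for the Boltzmann weights.
[cite: Ellis2006, §IV.5, proof of Thm. IV.5.5] -/
theorem isingWeight_add_field (Λ : Finset V) (β h s : ℝ) (bc : BoundaryCondition V) (τ : Λ → ℤˣ) :
    isingWeight G Λ β (h + s) bc τ =
      isingWeight G Λ β h bc τ * Real.exp (β * s * ∑ x ∈ Λ, spinAt x (glue Λ τ bc)) := by
  rw [isingWeight, isingWeight, ← Real.exp_add, isingHamiltonian_add_field]
  congr 1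
  ring

/-- **THE GIBBS MEASURES IN A FIELD ARE AN EXPONENTIAL FAMILY: `μ^{bc}_{Λ;β,h+s} = μ^{bc}_{Λ;β,h}` tilted by
`e^{βs M_Λ}`** (Mathlib `Measure.tilted`; both are tilts of the reference measure, `Measure.tilted_tilted`).
[cite: Ellis2006, §IV.5 eq. (4.33) and §VII.3 (tilted measures)] -/
theorem isingMeasure_add_field_eq_tilted (Λ : Finset V) (β h s : ℝ) (bc : BoundaryCondition V) :
    isingMeasure G Λ β (h + s) bc =
      (isingMeasure G Λ β h bc).tilted fun σ => β * s * ∑ x ∈ Λ, spinAt x σ := by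
  rw [isingMeasure, isingMeasure, tilted_tilted (integrable_exp_isingHamiltonian G Λ β h bc)]
  congr 1
  funext σ
  simp only [Pi.add_apply, isingHamiltonian_add_field]
  ring

/-! ### The moment generating function of `M_Λ`: `⟨e^{βs M_Λ}⟩_h = Z_{h+s}/Z_h` -/

/-- **`∫ e^{βs M_Λ} dμ^{bc}_{Λ;β,h} = Z^{bc}_{Λ;β,h+s} / Z^{bc}_{Λ;β,h}`** (every real `β`, `h`, `s`, every boundary
condition, every locally finite graph). [cite: Ellis2006, §IV.5 eq. (4.33)] -/
theorem integral_exp_mul_sum_spinAt (Λ : Finset V) (β h s : ℝ) (bc : BoundaryCondition V) :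
    ∫ σ, Real.exp (β * s * ∑ x ∈ Λ, spinAt x σ) ∂isingMeasure G Λ β h bc =
      isingPartitionFunction G Λ β (h + s) bc / isingPartitionFunction G Λ β h bc := by
  rw [integral_isingMeasure G Λ β h bc ((measurable_sum_spinAt Λ).const_mul (β * s)).exp,
    isingPartitionFunction, isingPartitionFunction]
  congr 1
  exact sum_congr rfl fun τ _ => (isingWeight_add_field G Λ β h s bc τ).symm

/-- **`mgf_{M_Λ}(βs) = Z_{h+s}/Z_h`** under `μ^{bc}_{Λ;β,h}` (Mathlib `ProbabilityTheory.mgf`).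
[cite: Ellis2006, §IV.5 eq. (4.33)] -/
theorem mgf_sum_spinAt (Λ : Finset V) (β h s : ℝ) (bc : BoundaryCondition V) :
    mgf (fun σ : SpinConfig V => ∑ x ∈ Λ, spinAt x σ) (isingMeasure G Λ β h bc) (β * s) =
      isingPartitionFunction G Λ β (h + s) bc / isingPartitionFunction G Λ β h bc := by
  rw [mgf]
  exact integral_exp_mul_sum_spinAt G Λ β h s bc

/-- **`cgf_{M_Λ}(βs) = log Z_{h+s} − log Z_h`** under `μ^{bc}_{Λ;β,h}` — Ellis' free energy function of the total
spin in finite volume, `c_{Λ,β,h}(t) |Λ| = log Z(h + t/β) − log Z(h)`, at `t = βs`.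
[cite: Ellis2006, §IV.5 eq. (4.33)] -/
theorem cgf_sum_spinAt (Λ : Finset V) (β h s : ℝ) (bc : BoundaryCondition V) :
    cgf (fun σ : SpinConfig V => ∑ x ∈ Λ, spinAt x σ) (isingMeasure G Λ β h bc) (β * s) =
      Real.log (isingPartitionFunction G Λ β (h + s) bc) - Real.log (isingPartitionFunction G Λ β h bc) := by
  rw [cgf, mgf_sum_spinAt, Real.log_div (isingPartitionFunction_pos G Λ β _ bc).ne'
    (isingPartitionFunction_pos G Λ β h bc).ne']

/-- `log Z^{bc}_{Λ;β,h} = |Λ| ψ^{bc}_Λ(β,h)` for nonempty `Λ`. [cite: FriedliVelenik2017, §3.2.1 Def. 3.5] -/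
theorem log_isingPartitionFunction_eq_card_mul_pressureIn {Λ : Finset V} (hΛ : Λ.Nonempty) (β h : ℝ)
    (bc : BoundaryCondition V) :
    Real.log (isingPartitionFunction G Λ β h bc) = #Λ * pressureIn G Λ β h bc := by
  have hpos : (0 : ℝ) < #Λ := by exact_mod_cast hΛ.card_pos
  rw [pressureIn, mul_div_cancel₀ _ hpos.ne']

/-- **`cgf_{M_Λ}(βs) = |Λ| (ψ^{bc}_Λ(β,h+s) − ψ^{bc}_Λ(β,h))`** (nonempty `Λ`): Ellis' (4.33) in finite volume,
`c_{Λ,β,h}(βs) = ψ_Λ(β,h+s) − ψ_Λ(β,h)` in the tree's sign convention `ψ = lim |Λ|⁻¹ log Z`.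
[cite: Ellis2006, §IV.5 eq. (4.33)] -/
theorem cgf_sum_spinAt_eq_card_mul {Λ : Finset V} (hΛ : Λ.Nonempty) (β h s : ℝ) (bc : BoundaryCondition V) :
    cgf (fun σ : SpinConfig V => ∑ x ∈ Λ, spinAt x σ) (isingMeasure G Λ β h bc) (β * s) =
      #Λ * (pressureIn G Λ β (h + s) bc - pressureIn G Λ β h bc) := by
  rw [cgf_sum_spinAt, log_isingPartitionFunction_eq_card_mul_pressureIn G hΛ,
    log_isingPartitionFunction_eq_card_mul_pressureIn G hΛ, mul_sub]

/-- `Z_{h+s}/Z_h = exp(|Λ| (ψ_Λ(h+s) − ψ_Λ(h)))` (nonempty `Λ`). [cite: Ellis2006, §IV.5 eq. (4.33)] -/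
theorem isingPartitionFunction_div_eq_exp_card_mul {Λ : Finset V} (hΛ : Λ.Nonempty) (β h s : ℝ)
    (bc : BoundaryCondition V) :
    isingPartitionFunction G Λ β (h + s) bc / isingPartitionFunction G Λ β h bc =
      Real.exp (#Λ * (pressureIn G Λ β (h + s) bc - pressureIn G Λ β h bc)) := by
  rw [← cgf_sum_spinAt_eq_card_mul G hΛ, cgf, mgf_sum_spinAt,
    Real.exp_log (div_pos (isingPartitionFunction_pos G Λ β _ bc) (isingPartitionFunction_pos G Λ β h bc))]

/-! ### Jensen / convexity: `βs Σ_x⟨σ_x⟩_h ≤ log Z_{h+s} − log Z_h ≤ βs Σ_x⟨σ_x⟩_{h+s}` -/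

/-- **`log Z_{h+s} − log Z_h ≤ βs Σ_{x∈Λ} ⟨σ_x⟩^{bc}_{Λ;β,h+s}`** (every real `β`, `h`, `s`): the tangent line of
the convex function `h ↦ log Z^{bc}_{Λ;β,h}` at `h + s`, whose slope is `β Σ_x ⟨σ_x⟩_{h+s}`
(`hasDerivAt_log_isingPartitionFunction_field`), lies below the graph.
[cite: FriedliVelenik2017, Lemma 3.5 and §3.7 proof of Prop. 3.29] -/
theorem log_sub_le_mul_sum_isingCorr (Λ : Finset V) (β h s : ℝ) (bc : BoundaryCondition V) :
    Real.log (isingPartitionFunction G Λ β (h + s) bc) - Real.log (isingPartitionFunction G Λ β h bc) ≤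
      β * s * ∑ x ∈ Λ, isingCorr G Λ β (h + s) bc {x} := by
  set f : ℝ → ℝ := fun t => Real.log (isingPartitionFunction G Λ β t bc) with hf
  have hconv : ConvexOn ℝ univ f := IsingSusceptibility.convexOn_log_isingPartitionFunction_field G Λ β bc
  have hder : HasDerivAt f (β * ∑ x ∈ Λ, isingCorr G Λ β (h + s) bc {x}) (h + s) :=
    hasDerivAt_log_isingPartitionFunction_field G Λ β (h + s) bc
  rcases lt_trichotomy s 0 with hs | hs | hs
  · -- `s < 0`: `f' (h+s) ≤ slope f (h+s) h`
    have hlt : h + s < h := by linarith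
    have h1 := hconv.le_slope_of_hasDerivAt (mem_univ _) (mem_univ _) hlt hder
    rw [slope_def_field] at h1
    have hpos : 0 < h - (h + s) := by linarith
    have h2 := (le_div_iff₀ hpos).1 h1
    change f (h + s) - f h ≤ _
    nlinarith
  · subst hs
    simp
  · -- `0 < s`: `slope f h (h+s) ≤ f' (h+s)`
    have hlt : h < h + s := by linarith
    have h1 := hconv.slope_le_of_hasDerivAt (mem_univ _) (mem_univ _) hlt hder
    rw [slope_def_field] at h1
    have hpos : 0 < h + s - h := by linarith
    have h2 := (div_le_iff₀ hpos).1 h1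
    change f (h + s) - f h ≤ _
    nlinarith

/-- **`βs Σ_{x∈Λ} ⟨σ_x⟩^{bc}_{Λ;β,h} ≤ log Z_{h+s} − log Z_h`** (every real `β`, `h`, `s`): the tangent line at `h`
(equivalently Jensen, `⟨e^{βs M_Λ}⟩_h ≥ e^{βs⟨M_Λ⟩_h}`). [cite: FriedliVelenik2017, Lemma 3.5 and §3.7 proof of Prop. 3.29] -/
theorem mul_sum_isingCorr_le_log_sub (Λ : Finset V) (β h s : ℝ) (bc : BoundaryCondition V) :
    β * s * ∑ x ∈ Λ, isingCorr G Λ β h bc {x} ≤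
      Real.log (isingPartitionFunction G Λ β (h + s) bc) - Real.log (isingPartitionFunction G Λ β h bc) := by
  have := log_sub_le_mul_sum_isingCorr G Λ β (h + s) (-s) bc
  simp only [add_neg_cancel_right] at this
  linarith

/-! ### Chernoff bounds: upper tail -/

/-- **CHERNOFF BOUND, UPPER TAIL: `μ^{bc}_{Λ;β,h}{a ≤ M_Λ} ≤ e^{−βsa} · Z^{bc}_{Λ;β,h+s}/Z^{bc}_{Λ;β,h}`** for
`βs ≥ 0` and every real `a` (exponential Chebyshev with the moment generating function `Z_{h+s}/Z_h`).
[cite: Ellis2006, Thm. II.6.1 (b) (proof, §VII.4) with §IV.5 eq. (4.33)] -/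
theorem measureReal_le_sum_spinAt_le (Λ : Finset V) {β s : ℝ} (hβs : 0 ≤ β * s) (h : ℝ)
    (bc : BoundaryCondition V) (a : ℝ) :
    (isingMeasure G Λ β h bc).real {σ | a ≤ ∑ x ∈ Λ, spinAt x σ} ≤
      Real.exp (-(β * s * a)) *
        (isingPartitionFunction G Λ β (h + s) bc / isingPartitionFunction G Λ β h bc) := by
  have hb := measure_ge_le_exp_mul_mgf (μ := isingMeasure G Λ β h bc)
    (X := fun σ : SpinConfig V => ∑ x ∈ Λ, spinAt x σ) a hβs
    (integrable_exp_mul_sum_spinAt Λ (isingMeasure G Λ β h bc) (β * s))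
  rwa [mgf_sum_spinAt, neg_mul] at hb

/-- **UPPER TAIL IN PRESSURE FORM: `μ^{bc}_{Λ;β,h}{m|Λ| ≤ M_Λ} ≤ exp(−|Λ| (βsm − (ψ^{bc}_Λ(β,h+s) − ψ^{bc}_Λ(β,h))))`**
for `βs ≥ 0`, nonempty `Λ`, every real `m`: the finite-volume large-deviation upper bound with Ellis' free energy
function `c_Λ(βs) = ψ_Λ(h+s) − ψ_Λ(h)`. [cite: Ellis2006, Thm. II.6.1 (b) with §IV.5 eq. (4.33)] -/
theorem measureReal_le_sum_spinAt_le_exp_card {Λ : Finset V} (hΛ : Λ.Nonempty) {β s : ℝ} (hβs : 0 ≤ β * s)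
    (h : ℝ) (bc : BoundaryCondition V) (m : ℝ) :
    (isingMeasure G Λ β h bc).real {σ | m * #Λ ≤ ∑ x ∈ Λ, spinAt x σ} ≤
      Real.exp (-(#Λ * (β * s * m - (pressureIn G Λ β (h + s) bc - pressureIn G Λ β h bc)))) := by
  refine (measureReal_le_sum_spinAt_le G Λ hβs h bc (m * #Λ)).trans (le_of_eq ?_)
  rw [isingPartitionFunction_div_eq_exp_card_mul G hΛ, ← Real.exp_add]
  congr 1
  ring

/-- **UPPER TAIL IN MEAN FORM: `μ^{bc}_{Λ;β,h}{a ≤ M_Λ} ≤ exp(−βs (a − Σ_{x∈Λ} ⟨σ_x⟩^{bc}_{Λ;β,h+s}))`** for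
`βs ≥ 0`: in finite volume the total spin exceeds the mean total spin AT THE SHIFTED FIELD `h + s` by `δ` with
probability at most `e^{−βsδ}` (Chernoff + the tangent bound `log Z_{h+s} − log Z_h ≤ βs Σ⟨σ_x⟩_{h+s}`).
[cite: Ellis2006, Thm. II.6.1 (b) with §IV.5 eq. (4.33); FriedliVelenik2017, Lemma 3.5] -/
theorem measureReal_le_sum_spinAt_le_exp_mean (Λ : Finset V) {β s : ℝ} (hβs : 0 ≤ β * s) (h : ℝ)
    (bc : BoundaryCondition V) (a : ℝ) :
    (isingMeasure G Λ β h bc).real {σ | a ≤ ∑ x ∈ Λ, spinAt x σ} ≤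
      Real.exp (-(β * s * (a - ∑ x ∈ Λ, isingCorr G Λ β (h + s) bc {x}))) := by
  refine (measureReal_le_sum_spinAt_le G Λ hβs h bc a).trans ?_
  have hZ : isingPartitionFunction G Λ β (h + s) bc / isingPartitionFunction G Λ β h bc =
      Real.exp (Real.log (isingPartitionFunction G Λ β (h + s) bc) -
        Real.log (isingPartitionFunction G Λ β h bc)) := by
    rw [Real.exp_sub, Real.exp_log (isingPartitionFunction_pos G Λ β _ bc),
      Real.exp_log (isingPartitionFunction_pos G Λ β h bc)]
  rw [hZ, ← Real.exp_add, Real.exp_le_exp]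
  have := log_sub_le_mul_sum_isingCorr G Λ β h s bc
  nlinarith

/-! ### Chernoff bounds: lower tail -/

/-- **CHERNOFF BOUND, LOWER TAIL: `μ^{bc}_{Λ;β,h}{M_Λ ≤ a} ≤ e^{βsa} · Z^{bc}_{Λ;β,h−s}/Z^{bc}_{Λ;β,h}`** for `βs ≥ 0`
and every real `a`. [cite: Ellis2006, Thm. II.6.1 (b) with §IV.5 eq. (4.33)] -/
theorem measureReal_sum_spinAt_le_le (Λ : Finset V) {β s : ℝ} (hβs : 0 ≤ β * s) (h : ℝ)
    (bc : BoundaryCondition V) (a : ℝ) :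
    (isingMeasure G Λ β h bc).real {σ | ∑ x ∈ Λ, spinAt x σ ≤ a} ≤
      Real.exp (β * s * a) *
        (isingPartitionFunction G Λ β (h - s) bc / isingPartitionFunction G Λ β h bc) := by
  have ht : β * (-s) ≤ 0 := by nlinarith
  have hb := measure_le_le_exp_mul_mgf (μ := isingMeasure G Λ β h bc)
    (X := fun σ : SpinConfig V => ∑ x ∈ Λ, spinAt x σ) a ht
    (integrable_exp_mul_sum_spinAt Λ (isingMeasure G Λ β h bc) (β * (-s)))
  rw [mgf_sum_spinAt, ← sub_eq_add_neg] at hb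
  refine hb.trans (le_of_eq ?_)
  congr 2
  ring

/-- **LOWER TAIL IN PRESSURE FORM: `μ^{bc}_{Λ;β,h}{M_Λ ≤ m|Λ|} ≤ exp(−|Λ| (−βsm − (ψ^{bc}_Λ(β,h−s) − ψ^{bc}_Λ(β,h))))`**
for `βs ≥ 0`, nonempty `Λ`. [cite: Ellis2006, Thm. II.6.1 (b) with §IV.5 eq. (4.33)] -/
theorem measureReal_sum_spinAt_le_le_exp_card {Λ : Finset V} (hΛ : Λ.Nonempty) {β s : ℝ} (hβs : 0 ≤ β * s)
    (h : ℝ) (bc : BoundaryCondition V) (m : ℝ) :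
    (isingMeasure G Λ β h bc).real {σ | ∑ x ∈ Λ, spinAt x σ ≤ m * #Λ} ≤
      Real.exp (-(#Λ * (-(β * s * m) - (pressureIn G Λ β (h - s) bc - pressureIn G Λ β h bc)))) := by
  refine (measureReal_sum_spinAt_le_le G Λ hβs h bc (m * #Λ)).trans (le_of_eq ?_)
  rw [sub_eq_add_neg h s, isingPartitionFunction_div_eq_exp_card_mul G hΛ, ← Real.exp_add, ← sub_eq_add_neg]
  congr 1
  ring

/-- **LOWER TAIL IN MEAN FORM: `μ^{bc}_{Λ;β,h}{M_Λ ≤ a} ≤ exp(βs (a − Σ_{x∈Λ} ⟨σ_x⟩^{bc}_{Λ;β,h−s}))`** for `βs ≥ 0`: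
the total spin falls `δ` below the mean total spin at the shifted field `h − s` with probability at most
`e^{−βsδ}`. [cite: Ellis2006, Thm. II.6.1 (b) with §IV.5 eq. (4.33); FriedliVelenik2017, Lemma 3.5] -/
theorem measureReal_sum_spinAt_le_le_exp_mean (Λ : Finset V) {β s : ℝ} (hβs : 0 ≤ β * s) (h : ℝ)
    (bc : BoundaryCondition V) (a : ℝ) :
    (isingMeasure G Λ β h bc).real {σ | ∑ x ∈ Λ, spinAt x σ ≤ a} ≤
      Real.exp (β * s * (a - ∑ x ∈ Λ, isingCorr G Λ β (h - s) bc {x})) := by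
  refine (measureReal_sum_spinAt_le_le G Λ hβs h bc a).trans ?_
  have hZ : isingPartitionFunction G Λ β (h - s) bc / isingPartitionFunction G Λ β h bc =
      Real.exp (Real.log (isingPartitionFunction G Λ β (h - s) bc) -
        Real.log (isingPartitionFunction G Λ β h bc)) := by
    rw [Real.exp_sub, Real.exp_log (isingPartitionFunction_pos G Λ β _ bc),
      Real.exp_log (isingPartitionFunction_pos G Λ β h bc)]
  rw [hZ, ← Real.exp_add, Real.exp_le_exp]
  -- tangent bound at `h - s`, read at `h = (h - s) + s`: `log Z_h − log Z_{h−s} ≥ βs Σ⟨σ_x⟩_{h−s}`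
  have := mul_sum_isingCorr_le_log_sub G Λ β (h - s) s bc
  simp only [sub_add_cancel] at this
  nlinarith

/-! ### Two-sided form -/

/-- **TWO-SIDED CHERNOFF BOUND IN MEAN FORM**: for `βs ≥ 0` and every real `δ`,
`μ^{bc}_{Λ;β,h}{M_Λ ∉ (Σ_x⟨σ_x⟩_{h−s} − δ, Σ_x⟨σ_x⟩_{h+s} + δ)} ≤ 2 e^{−βsδ}`: outside the window between the two
tilted mean total spins (fields `h ∓ s`), widened by `δ`, the total spin has probability exponentially small in
`βsδ`. [cite: Ellis2006, Thm. II.6.1 (b) with §IV.5 eq. (4.33)] -/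
theorem measureReal_sum_spinAt_not_mem_Ioo_le (Λ : Finset V) {β s : ℝ} (hβs : 0 ≤ β * s) (h : ℝ)
    (bc : BoundaryCondition V) (δ : ℝ) :
    (isingMeasure G Λ β h bc).real
        {σ | ∑ x ∈ Λ, spinAt x σ ∉ Ioo (∑ x ∈ Λ, isingCorr G Λ β (h - s) bc {x} - δ)
          (∑ x ∈ Λ, isingCorr G Λ β (h + s) bc {x} + δ)} ≤ 2 * Real.exp (-(β * s * δ)) := by
  set μ := isingMeasure G Λ β h bc with hμ
  set lo := ∑ x ∈ Λ, isingCorr G Λ β (h - s) bc {x} with hlo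
  set hi := ∑ x ∈ Λ, isingCorr G Λ β (h + s) bc {x} with hhi
  have hsub : {σ : SpinConfig V | ∑ x ∈ Λ, spinAt x σ ∉ Ioo (lo - δ) (hi + δ)} ⊆
      {σ | hi + δ ≤ ∑ x ∈ Λ, spinAt x σ} ∪ {σ | ∑ x ∈ Λ, spinAt x σ ≤ lo - δ} := by
    intro σ hσ
    simp only [mem_setOf_eq, Set.mem_Ioo, not_and_or, not_lt, Set.mem_union] at hσ ⊢
    rcases hσ with h1 | h1
    · exact Or.inr h1
    · exact Or.inl h1
  have hup : μ.real {σ | hi + δ ≤ ∑ x ∈ Λ, spinAt x σ} ≤ Real.exp (-(β * s * δ)) := by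
    refine (measureReal_le_sum_spinAt_le_exp_mean G Λ hβs h bc (hi + δ)).trans (le_of_eq ?_)
    rw [hhi]
    congr 1
    ring
  have hlow : μ.real {σ | ∑ x ∈ Λ, spinAt x σ ≤ lo - δ} ≤ Real.exp (-(β * s * δ)) := by
    refine (measureReal_sum_spinAt_le_le_exp_mean G Λ hβs h bc (lo - δ)).trans (le_of_eq ?_)
    rw [hlo]
    congr 1
    ring
  calc μ.real {σ | ∑ x ∈ Λ, spinAt x σ ∉ Ioo (lo - δ) (hi + δ)}
      ≤ μ.real ({σ | hi + δ ≤ ∑ x ∈ Λ, spinAt x σ} ∪ {σ | ∑ x ∈ Λ, spinAt x σ ≤ lo - δ}) :=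
        measureReal_mono hsub
    _ ≤ μ.real {σ | hi + δ ≤ ∑ x ∈ Λ, spinAt x σ} + μ.real {σ | ∑ x ∈ Λ, spinAt x σ ≤ lo - δ} :=
        measureReal_union_le _ _
    _ ≤ 2 * Real.exp (-(β * s * δ)) := by linarith

end IsingLargeDeviations

end Summit.CriticalPhenomena.PercolationContinuityZ3.Theorems.FK
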